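import Literature.NumberTheory.Automorphic.Liu2021.Def411WeilCarriersDoublingSum
import Literature.NumberTheory.GelbartRogawski1991.DoubledSeesawUndoubling
import HarnessLib

/-!
# The V-side see-saw character of the `χ`-splitting triple over a hermitian line is trivial on `U(V₁)(𝔸) × 1 × 1`

`seesawCharChiSplittingLineTrivial_holds : seesawCharChiSplittingLineTrivial` (`Def411WeilCarriersDoublingSum`): for the
`χ`-attached splittings ([Liu2021, App. D §D.1 Steps 1–2]: `ι_μ` determined by doubling, [Kudla1994, §2, Thm. 3.1],
[HarrisKudlaSweet1996, §1 (1.14)–(1.15)]) of the three dual pairs `(U(diag(dV₁ ‖ dV₂)), U(⟨T_W⟩))`, `(U(diag dV_j), U(⟨T_W⟩))`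
with the SAME unitary `χ`, the V-side see-saw character `mpSeesawCharLeft` ([Kudla1984, §1]; [GelbartRogawski1991, §3.1 Remark
p. 457]) is `1` at `((g₁, 1), 1)` — the see-saw step «the restriction of `ω_{μ,ε}` to `U(V⋆)` … with the same `μ`» of the proof of
[Liu2021, Thm. 4.15] (l. 2199–2210), with NO character, for pure tensors.

* §U4a `ω`-level transport through `splittingCongr` / `splittingCongrV` (`subst; rfl` — the `χ`-splitting over the line, resp. over
  the orthogonal sum, is the lane's `chiSplitting` read over transported Gram data);
* §U4b the three see-saw values at `((g₁,1),1)` read back along the enumerations and transported to the lane's diagonal data,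
  `reindex e_Σ e_Σ ((g₁ ⊕ᶠ 1) ⊗ 1) = diag(g₁ ⊗ 1, 1)`, the pure-tensor identity `omega_seesawBigLeft_chiSplittingSum_inl`
  (from the enumerated-coordinate core `omega_chiSplitting_sumTensor_idxSplit` of `GelbartRogawski1991/DoubledSeesawUndoubling`),
  and the statement by uniqueness of the see-saw scalar (`coe_mpSeesawChar_eq`, `c := 1`).

References: [Liu2021] Y. Liu, Camb. J. Math. 9 (2021), proof of Thm. 4.15 (arXiv `FJcycle.tex` l. 2199–2210), App. D §D.1
(l. 5217–5219); [Kudla1994] S. Kudla, Israel J. Math. 87 (1994) §2, Thm. 3.1; [Kudla1984] S. Kudla, Progr. Math. 46 (1984) §1;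
[GelbartRogawski1991] Invent. Math. 105 (1991) §3.1 Prop. 3.1.1 p. 455, Remark p. 457; [HarrisKudlaSweet1996] J. AMS 9 (1996) §1.
-/

set_option autoImplicit false

noncomputable section

open scoped Classical
open scoped Matrix Kronecker
open NumberField IsDedekindDomain
open Literature.RepresentationTheory.HeisenbergGroup
open Literature.NumberTheory.Automorphic
open Literature.NumberTheory.Weil1964
open Literature.RepresentationTheory.HarrisKudlaSweet1996
open Literature.NumberTheory.GaloisRepresentations

/-! ## §U4a Transport through `splittingCongr` / `splittingCongrV` -/

namespace Literature.NumberTheory.Automorphic.Liu2021.Def411WeilCarriersDoubling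

open Literature.NumberTheory.GelbartRogawski1991 Literature.NumberTheory.GelbartRogawski1991.UnitaryDualPair
open Literature.NumberTheory.GelbartRogawski1991.GRConstruction

section Transport

variable (F E : Type) [Field F] [NumberField F] [Field E] [NumberField E] [Algebra F E]
variable (c : E ≃ₐ[F] E) (N M : ℕ) {n : ℕ} (e : Fin N × Fin M ≃ Fin n)

omit [NumberField F] in
/-- membership in `G₁(𝔸) = U(J_V ⊗ J_W)(𝔸)` is transported along equal Gram matrices (same underlying matrix).
[cite: GelbartRogawski1991, §3.2 p. 457] -/
theorem mem_adelicPair_of_eq {JV JV' : Matrix (Fin N) (Fin N) E} {JW JW' : Matrix (Fin M) (Fin M) E} (hV : JV = JV')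
    (hW : JW = JW') {g : GL (Fin N × Fin M) (AdeleRing (𝓞 E) E)} (hg : g ∈ UnitaryGroup.adelicPair F E c N M JV JW) :
    g ∈ UnitaryGroup.adelicPair F E c N M JV' JW' := by
  subst hV hW
  exact hg

/-- **`ω`-values are transported along equal W-side Gram data on the nose**:
`ω(splittingCongr hT hJ s x') Φ = ω(s x) Φ`, `x` = the matrix of `x'` read over `J_W`.
[cite: GelbartRogawski1991, §3.1 Prop. 3.1.1 p. 455 L1–3] -/
theorem omega_splittingCongr_apply (JV : Matrix (Fin N) (Fin N) E) {TV : Matrix (Fin N) (Fin N) F}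
    {TW TW' : Matrix (Fin M) (Fin M) F} {JW JW' : Matrix (Fin M) (Fin M) E} (hT : TW = TW') (hJ : JW = JW')
    (s : UnitaryGroup.adelicPair F E c N M JV JW →* adelicMpCont F (Fin n) (adelicGram F e TV TW))
    (x' : UnitaryGroup.adelicPair F E c N M JV JW') (Φ : piSchwartzBruhat F (Fin n)) :
    adelicMpCont.omega F (Fin n) (adelicGram F e TV TW') (splittingCongr F E c N M e JV hT hJ s x') Φ =
      adelicMpCont.omega F (Fin n) (adelicGram F e TV TW)
        (s ⟨x', mem_adelicPair_of_eq F E c N M rfl hJ.symm x'.2⟩) Φ := by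
  subst hT hJ
  rfl

/-- **`ω`-values are transported along equal V-side Gram data on the nose** (`splittingCongrV`).
[cite: GelbartRogawski1991, §3.1 Prop. 3.1.1 p. 455 L1–3] -/
theorem omega_splittingCongrV_apply {JV JV' : Matrix (Fin N) (Fin N) E} {TV TV' : Matrix (Fin N) (Fin N) F}
    (JW : Matrix (Fin M) (Fin M) E) {TW : Matrix (Fin M) (Fin M) F} (hT : TV = TV') (hJ : JV = JV')
    (s : UnitaryGroup.adelicPair F E c N M JV JW →* adelicMpCont F (Fin n) (adelicGram F e TV TW))
    (x' : UnitaryGroup.adelicPair F E c N M JV' JW) (Φ : piSchwartzBruhat F (Fin n)) :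
    adelicMpCont.omega F (Fin n) (adelicGram F e TV' TW) (splittingCongrV F E c N M e JW hT hJ s x') Φ =
      adelicMpCont.omega F (Fin n) (adelicGram F e TV TW)
        (s ⟨x', mem_adelicPair_of_eq F E c N M hJ.symm rfl x'.2⟩) Φ := by
  subst hT hJ
  rfl

end Transport

/-! ## §U4b The see-saw values at `((g₁,1),1)` and the statement -/

section Socket

variable (L : Type) [Field L] [NumberField L] [IsCMField L]

local notation "𝔸L" => AdeleRing (𝓞 L) L
local notation "𝔸⁺" => AdeleRing (𝓞 (Fp L)) (Fp L)

variable {N₁ N₂ n n₁ n₂ : ℕ} (eV : Fin (N₁ + N₂) × Fin 1 ≃ Fin n) (e₁ : Fin N₁ × Fin 1 ≃ Fin n₁) (e₂ : Fin N₂ × Fin 1 ≃ Fin n₂)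
  (dV₁ : Fin N₁ → L) (hdV₁ : ∀ i, IsCMField.complexConj L (dV₁ i) = dV₁ i) (hdV₁0 : ∀ i, dV₁ i ≠ 0)
  (dV₂ : Fin N₂ → L) (hdV₂ : ∀ i, IsCMField.complexConj L (dV₂ i) = dV₂ i) (hdV₂0 : ∀ i, dV₂ i ≠ 0)
  (χ : HeckeCharacter L) (hχu : χ.IsUnitary) (hχs : IsSplittingChar L 1 χ)
  (TW : Matrix (Fin 1) (Fin 1) (Fp L)) (hWd : IsUnit TW.det) (JW : Matrix (Fin 1) (Fin 1) L)
  (hJW : JW = TW.map (algebraMap (Fp L) L))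

/-- `reindex e_Σ e_Σ ((g₁ ⊕ᶠ 1) ⊗ 1) = diag(g₁ ⊗ 1, 1)`: the hypothesis of the core at the socket's element. [cite: Kudla1984, §1] -/
theorem reindex_inlSumDiag (g₁ : ↥(UnitaryGroup.adelic (Fp L) L (IsCMField.complexConj L) N₁ (Matrix.diagonal dV₁))) :
    Matrix.reindex
        ((finSumFinEquiv.prodCongr (Equiv.refl (Fin 1))).symm.trans (Equiv.sumProdDistrib (Fin N₁) (Fin N₂) (Fin 1)))
        ((finSumFinEquiv.prodCongr (Equiv.refl (Fin 1))).symm.trans (Equiv.sumProdDistrib (Fin N₁) (Fin N₂) (Fin 1)))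
        (((UnitaryGroup.adelicInl (Fp L) L (IsCMField.complexConj L) (N₁ + N₂) 1
          (UnitaryGroup.finSum N₁ N₂ (Matrix.diagonal dV₁) (Matrix.diagonal dV₂)) JW
          (UnitaryGroup.adelicBlockDiag (Fp L) L (IsCMField.complexConj L) N₁ N₂ (Matrix.diagonal dV₁) (Matrix.diagonal dV₂)
            (g₁, 1)) *
        UnitaryGroup.adelicInr (Fp L) L (IsCMField.complexConj L) (N₁ + N₂) 1
          (UnitaryGroup.finSum N₁ N₂ (Matrix.diagonal dV₁) (Matrix.diagonal dV₂)) JW 1).1 : GL (Fin (N₁ + N₂) × Fin 1) 𝔸L) : Matrix (Fin (N₁ + N₂) × Fin 1) (Fin (N₁ + N₂) × Fin 1) 𝔸L) =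
      Matrix.fromBlocks (((UnitaryGroup.adelicInl (Fp L) L (IsCMField.complexConj L) N₁ 1 (Matrix.diagonal dV₁) JW g₁ *
        UnitaryGroup.adelicInr (Fp L) L (IsCMField.complexConj L) N₁ 1 (Matrix.diagonal dV₁) JW 1).1 : GL (Fin N₁ × Fin 1) 𝔸L) : Matrix (Fin N₁ × Fin 1) (Fin N₁ × Fin 1) 𝔸L) 0 0 1 := by
  rw [map_one, mul_one, map_one, mul_one, UnitaryGroup.coe_adelicInl, UnitaryGroup.coe_adelicInl,
    UnitaryGroup.coe_adelicBlockDiag, UnitaryGroup.coe_reindexGL, UnitaryGroup.coe_blockDiagGL, OneMemClass.coe_one,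
    Units.val_one, ← Matrix.one_kronecker_one (m := Fin N₂) (n := Fin 1), ← UnitaryGroup.reindex_finSum_kronecker]
  rfl

/-- **the big see-saw value at `((g₁,1),1)`, transported to the lane's diagonal data**:
`ω(s_pair^{V₁⊕V₂}((g₁ ⊕ᶠ 1), 1)) Ψ = ω(s_χ^V ((g₁ ⊕ᶠ 1) ⊗ 1 read over diag(dV₁ ‖ dV₂))) Ψ` (`chiSplittingSum = splittingCongrV ∘ splittingCongr ∘ chiSplitting`).
[cite: Liu2021, App. D §D.1 Steps 1–2 (l. 5217–5219)] [cite: GelbartRogawski1991, §3.1 Prop. 3.1.1 p. 455 L1–3] -/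
theorem omega_pairSplitting_chiSplittingSum_inl
    (g₁ : ↥(UnitaryGroup.adelic (Fp L) L (IsCMField.complexConj L) N₁ (Matrix.diagonal dV₁)))
    (Ψ : piSchwartzBruhat (Fp L) (Fin n)) :
    adelicMpCont.omega (Fp L) (Fin n)
        (adelicGram (Fp L) eV (UnitaryGroup.finSum N₁ N₂ (realDiagonal L dV₁ hdV₁) (realDiagonal L dV₂ hdV₂)) TW)
        (pairSplitting (Fp L) L (IsCMField.complexConj L) (N₁ + N₂) 1 eV
          (UnitaryGroup.finSum N₁ N₂ (Matrix.diagonal dV₁) (Matrix.diagonal dV₂)) JW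
          (chiSplittingSum L eV dV₁ hdV₁ hdV₁0 dV₂ hdV₂ hdV₂0 χ hχu hχs TW hWd JW hJW)
          (UnitaryGroup.adelicBlockDiag (Fp L) L (IsCMField.complexConj L) N₁ N₂ (Matrix.diagonal dV₁) (Matrix.diagonal dV₂)
            (g₁, 1), 1)) Ψ =
      adelicMpCont.omega (Fp L) (Fin n)
        (gramA L eV (Fin.append dV₁ dV₂) (complexConj_append L dV₁ dV₂ hdV₁ hdV₂) (lineW L TW) (complexConj_lineW L TW))
        (chiSplitting L eV (Fin.append dV₁ dV₂) (complexConj_append L dV₁ dV₂ hdV₁ hdV₂) (append_ne_zero dV₁ dV₂ hdV₁0 hdV₂0)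
          (lineW L TW) (complexConj_lineW L TW) (lineW_ne_zero L TW hWd) χ hχu hχs (⟨(UnitaryGroup.adelicInl (Fp L) L (IsCMField.complexConj L) (N₁ + N₂) 1
          (UnitaryGroup.finSum N₁ N₂ (Matrix.diagonal dV₁) (Matrix.diagonal dV₂)) JW
          (UnitaryGroup.adelicBlockDiag (Fp L) L (IsCMField.complexConj L) N₁ N₂ (Matrix.diagonal dV₁) (Matrix.diagonal dV₂)
            (g₁, 1)) *
        UnitaryGroup.adelicInr (Fp L) L (IsCMField.complexConj L) (N₁ + N₂) 1
          (UnitaryGroup.finSum N₁ N₂ (Matrix.diagonal dV₁) (Matrix.diagonal dV₂)) JW 1).1,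
        mem_adelicPair_of_eq (Fp L) L (IsCMField.complexConj L) (N₁ + N₂) 1 (finSum_diagonal_append dV₁ dV₂)
          (diagonal_lineW L TW hJW).symm
          (UnitaryGroup.adelicInl (Fp L) L (IsCMField.complexConj L) (N₁ + N₂) 1
          (UnitaryGroup.finSum N₁ N₂ (Matrix.diagonal dV₁) (Matrix.diagonal dV₂)) JW
          (UnitaryGroup.adelicBlockDiag (Fp L) L (IsCMField.complexConj L) N₁ N₂ (Matrix.diagonal dV₁) (Matrix.diagonal dV₂)
            (g₁, 1)) *
        UnitaryGroup.adelicInr (Fp L) L (IsCMField.complexConj L) (N₁ + N₂) 1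
          (UnitaryGroup.finSum N₁ N₂ (Matrix.diagonal dV₁) (Matrix.diagonal dV₂)) JW 1).2⟩ :
        ↥(UnitaryGroup.adelicPair (Fp L) L (IsCMField.complexConj L) (N₁ + N₂) 1 (Matrix.diagonal (Fin.append dV₁ dV₂))
          (Matrix.diagonal (lineW L TW))))) Ψ :=
  (omega_splittingCongrV_apply (Fp L) L (IsCMField.complexConj L) (N₁ + N₂) 1 eV JW
      (finSum_realDiagonal_append L dV₁ dV₂ hdV₁ hdV₂).symm (finSum_diagonal_append dV₁ dV₂).symm
      (chiSplittingLine L eV (Fin.append dV₁ dV₂) (complexConj_append L dV₁ dV₂ hdV₁ hdV₂)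
        (append_ne_zero dV₁ dV₂ hdV₁0 hdV₂0) χ hχu hχs TW hWd JW hJW) (UnitaryGroup.adelicInl (Fp L) L (IsCMField.complexConj L) (N₁ + N₂) 1
          (UnitaryGroup.finSum N₁ N₂ (Matrix.diagonal dV₁) (Matrix.diagonal dV₂)) JW
          (UnitaryGroup.adelicBlockDiag (Fp L) L (IsCMField.complexConj L) N₁ N₂ (Matrix.diagonal dV₁) (Matrix.diagonal dV₂)
            (g₁, 1)) *
        UnitaryGroup.adelicInr (Fp L) L (IsCMField.complexConj L) (N₁ + N₂) 1
          (UnitaryGroup.finSum N₁ N₂ (Matrix.diagonal dV₁) (Matrix.diagonal dV₂)) JW 1) Ψ).trans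
    (omega_splittingCongr_apply (Fp L) L (IsCMField.complexConj L) (N₁ + N₂) 1 eV (Matrix.diagonal (Fin.append dV₁ dV₂))
      (realDiagonal_lineW L TW) (diagonal_lineW L TW hJW)
      (chiSplitting L eV (Fin.append dV₁ dV₂) (complexConj_append L dV₁ dV₂ hdV₁ hdV₂) (append_ne_zero dV₁ dV₂ hdV₁0 hdV₂0)
        (lineW L TW) (complexConj_lineW L TW) (lineW_ne_zero L TW hWd) χ hχu hχs) _ Ψ)

/-- **the first small see-saw value at `((g₁,1),1)`, transported**: `ω(s_pair^{V₁}(g₁, 1)) Ψ = ω(s_χ^{V₁} (g₁ ⊗ 1)) Ψ`.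
[cite: Liu2021, App. D §D.1 Steps 1–2 (l. 5217–5219)] [cite: GelbartRogawski1991, §3.1 Prop. 3.1.1 p. 455 L1–3] -/
theorem omega_pairSplitting_chiSplittingLine_inl
    (g₁ : ↥(UnitaryGroup.adelic (Fp L) L (IsCMField.complexConj L) N₁ (Matrix.diagonal dV₁)))
    (Ψ : piSchwartzBruhat (Fp L) (Fin n₁)) :
    adelicMpCont.omega (Fp L) (Fin n₁) (adelicGram (Fp L) e₁ (realDiagonal L dV₁ hdV₁) TW)
        (pairSplitting (Fp L) L (IsCMField.complexConj L) N₁ 1 e₁ (Matrix.diagonal dV₁) JW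
          (chiSplittingLine L e₁ dV₁ hdV₁ hdV₁0 χ hχu hχs TW hWd JW hJW) (g₁, 1)) Ψ =
      adelicMpCont.omega (Fp L) (Fin n₁) (gramA L e₁ dV₁ hdV₁ (lineW L TW) (complexConj_lineW L TW))
        (chiSplitting L e₁ dV₁ hdV₁ hdV₁0 (lineW L TW) (complexConj_lineW L TW) (lineW_ne_zero L TW hWd) χ hχu hχs
          (⟨(UnitaryGroup.adelicInl (Fp L) L (IsCMField.complexConj L) N₁ 1 (Matrix.diagonal dV₁) JW g₁ *
        UnitaryGroup.adelicInr (Fp L) L (IsCMField.complexConj L) N₁ 1 (Matrix.diagonal dV₁) JW 1).1,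
        mem_adelicPair_of_eq (Fp L) L (IsCMField.complexConj L) N₁ 1 rfl (diagonal_lineW L TW hJW).symm
          (UnitaryGroup.adelicInl (Fp L) L (IsCMField.complexConj L) N₁ 1 (Matrix.diagonal dV₁) JW g₁ *
        UnitaryGroup.adelicInr (Fp L) L (IsCMField.complexConj L) N₁ 1 (Matrix.diagonal dV₁) JW 1).2⟩ :
        ↥(UnitaryGroup.adelicPair (Fp L) L (IsCMField.complexConj L) N₁ 1 (Matrix.diagonal dV₁) (Matrix.diagonal (lineW L TW))))) Ψ :=
  omega_splittingCongr_apply (Fp L) L (IsCMField.complexConj L) N₁ 1 e₁ (Matrix.diagonal dV₁) (realDiagonal_lineW L TW)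
    (diagonal_lineW L TW hJW)
    (chiSplitting L e₁ dV₁ hdV₁ hdV₁0 (lineW L TW) (complexConj_lineW L TW) (lineW_ne_zero L TW hWd) χ hχu hχs)
    (UnitaryGroup.adelicInl (Fp L) L (IsCMField.complexConj L) N₁ 1 (Matrix.diagonal dV₁) JW g₁ *
        UnitaryGroup.adelicInr (Fp L) L (IsCMField.complexConj L) N₁ 1 (Matrix.diagonal dV₁) JW 1) Ψ

/-- **the second small see-saw value at `((g₁,1),1)` is the identity**: `ω(s_pair^{V₂}(1, 1)) Ψ = Ψ`.
[cite: GelbartRogawski1991, §3.1 Prop. 3.1.1 p. 455 L1–3] -/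
theorem omega_pairSplitting_chiSplittingLine_one (Ψ : piSchwartzBruhat (Fp L) (Fin n₂)) :
    adelicMpCont.omega (Fp L) (Fin n₂) (adelicGram (Fp L) e₂ (realDiagonal L dV₂ hdV₂) TW)
        (pairSplitting (Fp L) L (IsCMField.complexConj L) N₂ 1 e₂ (Matrix.diagonal dV₂) JW
          (chiSplittingLine L e₂ dV₂ hdV₂ hdV₂0 χ hχu hχs TW hWd JW hJW) (1, 1)) Ψ = Ψ := by
  have h1 : pairSplitting (Fp L) L (IsCMField.complexConj L) N₂ 1 e₂ (Matrix.diagonal dV₂) JW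
      (chiSplittingLine L e₂ dV₂ hdV₂ hdV₂0 χ hχu hχs TW hWd JW hJW) (1, 1) = 1 :=
    map_one (pairSplitting (Fp L) L (IsCMField.complexConj L) N₂ 1 e₂ (Matrix.diagonal dV₂) JW
      (chiSplittingLine L e₂ dV₂ hdV₂ hdV₂0 χ hχu hχs TW hWd JW hJW))
  exact (congrArg (fun m => adelicMpCont.omega (Fp L) (Fin n₂) (adelicGram (Fp L) e₂ (realDiagonal L dV₂ hdV₂) TW) m Ψ)
    h1).trans (LinearMap.congr_fun (map_one (adelicMpCont.omega (Fp L) (Fin n₂)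
      (adelicGram (Fp L) e₂ (realDiagonal L dV₂ hdV₂) TW))) Ψ)

/-- **The V-side restriction identity for the `χ`-splittings, pure tensors, no character**: at `p = ((g₁, 1), 1)`
`ω(seesawBigLeft s_χ^{V₁⊕V₂} p) (Φ₁ ⊠_{e_Σ} Φ₂) = ω(seesawSmallLeft₁ s_χ^{V₁} p) Φ₁ ⊠_{e_Σ} ω(seesawSmallLeft₂ s_χ^{V₂} p) Φ₂`
— [Liu2021]'s «the restriction of `ω_{μ,ε}` to `U(V⋆)` … with the same `μ`» for pure tensors.
[cite: Liu2021, Thm. 4.15 proof l. 2199–2210] [cite: Kudla1994, §2 (doubled space, Siegel parabolic), Thm. 3.1] [cite: Kudla1984, §1] -/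
theorem omega_seesawBigLeft_chiSplittingSum_inl
    (g₁ : ↥(UnitaryGroup.adelic (Fp L) L (IsCMField.complexConj L) N₁ (Matrix.diagonal dV₁)))
    (Φ₁ : piSchwartzBruhat (Fp L) (Fin N₁ × Fin 1)) (Φ₂ : piSchwartzBruhat (Fp L) (Fin N₂ × Fin 1)) :
    adelicMpCont.omega (Fp L) (Fin (N₁ + N₂) × Fin 1)
        ((UnitaryGroup.finSum N₁ N₂ (realDiagonal L dV₁ hdV₁) (realDiagonal L dV₂ hdV₂)).map (algebraMap (Fp L) 𝔸⁺) ⊗ₖ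
          TW.map (algebraMap (Fp L) 𝔸⁺))
        (seesawBigLeft (Fp L) L (IsCMField.complexConj L) N₁ N₂ 1 eV (Matrix.diagonal dV₁) (Matrix.diagonal dV₂) JW
          (chiSplittingSum L eV dV₁ hdV₁ hdV₁0 dV₂ hdV₂ hdV₂0 χ hχu hχs TW hWd JW hJW) ((g₁, 1), 1))
        (sumTensor (Fp L) ((finSumFinEquiv.prodCongr (Equiv.refl (Fin 1))).symm.trans
          (Equiv.sumProdDistrib (Fin N₁) (Fin N₂) (Fin 1))) Φ₁ Φ₂) =
      sumTensor (Fp L) ((finSumFinEquiv.prodCongr (Equiv.refl (Fin 1))).symm.trans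
          (Equiv.sumProdDistrib (Fin N₁) (Fin N₂) (Fin 1)))
        (adelicMpCont.omega (Fp L) (Fin N₁ × Fin 1)
          ((realDiagonal L dV₁ hdV₁).map (algebraMap (Fp L) 𝔸⁺) ⊗ₖ TW.map (algebraMap (Fp L) 𝔸⁺))
          (seesawSmallLeft₁ (Fp L) L (IsCMField.complexConj L) N₁ N₂ 1 e₁ (Matrix.diagonal dV₁) (Matrix.diagonal dV₂) JW
            (chiSplittingLine L e₁ dV₁ hdV₁ hdV₁0 χ hχu hχs TW hWd JW hJW) ((g₁, 1), 1)) Φ₁)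
        (adelicMpCont.omega (Fp L) (Fin N₂ × Fin 1)
          ((realDiagonal L dV₂ hdV₂).map (algebraMap (Fp L) 𝔸⁺) ⊗ₖ TW.map (algebraMap (Fp L) 𝔸⁺))
          (seesawSmallLeft₂ (Fp L) L (IsCMField.complexConj L) N₁ N₂ 1 e₂ (Matrix.diagonal dV₁) (Matrix.diagonal dV₂) JW
            (chiSplittingLine L e₂ dV₂ hdV₂ hdV₂0 χ hχu hχs TW hWd JW hJW) ((g₁, 1), 1)) Φ₂) := by
  -- the three see-saw values read back along the enumerations (★ `omega_seesaw*_apply`), then the transports,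
  -- the coordinate lemmas of §U1 and THE CORE of §U3 at `M := 1`, `dW := lineW T_W`, `dV := dV₁ ‖ dV₂`
  have core := omega_chiSplitting_sumTensor_idxSplit L eV e₁ e₂ dV₁ hdV₁ hdV₁0 dV₂ hdV₂ hdV₂0 (Fin.append dV₁ dV₂)
    (complexConj_append L dV₁ dV₂ hdV₁ hdV₂) (append_ne_zero dV₁ dV₂ hdV₁0 hdV₂0) (fun i => Fin.append_left dV₁ dV₂ i)
    (fun j => Fin.append_right dV₁ dV₂ j) (lineW L TW) (complexConj_lineW L TW) (lineW_ne_zero L TW hWd) χ hχu hχs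
    (⟨(UnitaryGroup.adelicInl (Fp L) L (IsCMField.complexConj L) (N₁ + N₂) 1
          (UnitaryGroup.finSum N₁ N₂ (Matrix.diagonal dV₁) (Matrix.diagonal dV₂)) JW
          (UnitaryGroup.adelicBlockDiag (Fp L) L (IsCMField.complexConj L) N₁ N₂ (Matrix.diagonal dV₁) (Matrix.diagonal dV₂)
            (g₁, 1)) *
        UnitaryGroup.adelicInr (Fp L) L (IsCMField.complexConj L) (N₁ + N₂) 1
          (UnitaryGroup.finSum N₁ N₂ (Matrix.diagonal dV₁) (Matrix.diagonal dV₂)) JW 1).1,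
        mem_adelicPair_of_eq (Fp L) L (IsCMField.complexConj L) (N₁ + N₂) 1 (finSum_diagonal_append dV₁ dV₂)
          (diagonal_lineW L TW hJW).symm
          (UnitaryGroup.adelicInl (Fp L) L (IsCMField.complexConj L) (N₁ + N₂) 1
          (UnitaryGroup.finSum N₁ N₂ (Matrix.diagonal dV₁) (Matrix.diagonal dV₂)) JW
          (UnitaryGroup.adelicBlockDiag (Fp L) L (IsCMField.complexConj L) N₁ N₂ (Matrix.diagonal dV₁) (Matrix.diagonal dV₂)
            (g₁, 1)) *
        UnitaryGroup.adelicInr (Fp L) L (IsCMField.complexConj L) (N₁ + N₂) 1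
          (UnitaryGroup.finSum N₁ N₂ (Matrix.diagonal dV₁) (Matrix.diagonal dV₂)) JW 1).2⟩ :
        ↥(UnitaryGroup.adelicPair (Fp L) L (IsCMField.complexConj L) (N₁ + N₂) 1 (Matrix.diagonal (Fin.append dV₁ dV₂))
          (Matrix.diagonal (lineW L TW)))) (⟨(UnitaryGroup.adelicInl (Fp L) L (IsCMField.complexConj L) N₁ 1 (Matrix.diagonal dV₁) JW g₁ *
        UnitaryGroup.adelicInr (Fp L) L (IsCMField.complexConj L) N₁ 1 (Matrix.diagonal dV₁) JW 1).1,
        mem_adelicPair_of_eq (Fp L) L (IsCMField.complexConj L) N₁ 1 rfl (diagonal_lineW L TW hJW).symm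
          (UnitaryGroup.adelicInl (Fp L) L (IsCMField.complexConj L) N₁ 1 (Matrix.diagonal dV₁) JW g₁ *
        UnitaryGroup.adelicInr (Fp L) L (IsCMField.complexConj L) N₁ 1 (Matrix.diagonal dV₁) JW 1).2⟩ :
        ↥(UnitaryGroup.adelicPair (Fp L) L (IsCMField.complexConj L) N₁ 1 (Matrix.diagonal dV₁) (Matrix.diagonal (lineW L TW)))) (reindex_inlSumDiag L dV₁ dV₂ JW g₁)
    (piSBReindex (Fp L) e₁ Φ₁) (piSBReindex (Fp L) e₂ Φ₂)
  calc
    _ = (piSBReindex (Fp L) eV).symm (adelicMpCont.omega (Fp L) (Fin n)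
          (adelicGram (Fp L) eV (UnitaryGroup.finSum N₁ N₂ (realDiagonal L dV₁ hdV₁) (realDiagonal L dV₂ hdV₂)) TW)
          (pairSplitting (Fp L) L (IsCMField.complexConj L) (N₁ + N₂) 1 eV
            (UnitaryGroup.finSum N₁ N₂ (Matrix.diagonal dV₁) (Matrix.diagonal dV₂)) JW
            (chiSplittingSum L eV dV₁ hdV₁ hdV₁0 dV₂ hdV₂ hdV₂0 χ hχu hχs TW hWd JW hJW)
            (UnitaryGroup.adelicBlockDiag (Fp L) L (IsCMField.complexConj L) N₁ N₂ (Matrix.diagonal dV₁) (Matrix.diagonal dV₂)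
              (g₁, 1), 1))
          (piSBReindex (Fp L) eV (sumTensor (Fp L) ((finSumFinEquiv.prodCongr (Equiv.refl (Fin 1))).symm.trans
            (Equiv.sumProdDistrib (Fin N₁) (Fin N₂) (Fin 1))) Φ₁ Φ₂))) :=
      omega_seesawBigLeft_apply (Fp L) L (IsCMField.complexConj L) N₁ N₂ 1 eV (Matrix.diagonal dV₁) (Matrix.diagonal dV₂) JW
        (chiSplittingSum L eV dV₁ hdV₁ hdV₁0 dV₂ hdV₂ hdV₂0 χ hχu hχs TW hWd JW hJW) ((g₁, 1), 1) _
    _ = (piSBReindex (Fp L) eV).symm (adelicMpCont.omega (Fp L) (Fin n)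
          (gramA L eV (Fin.append dV₁ dV₂) (complexConj_append L dV₁ dV₂ hdV₁ hdV₂) (lineW L TW) (complexConj_lineW L TW))
          (chiSplitting L eV (Fin.append dV₁ dV₂) (complexConj_append L dV₁ dV₂ hdV₁ hdV₂) (append_ne_zero dV₁ dV₂ hdV₁0 hdV₂0)
            (lineW L TW) (complexConj_lineW L TW) (lineW_ne_zero L TW hWd) χ hχu hχs (⟨(UnitaryGroup.adelicInl (Fp L) L (IsCMField.complexConj L) (N₁ + N₂) 1
          (UnitaryGroup.finSum N₁ N₂ (Matrix.diagonal dV₁) (Matrix.diagonal dV₂)) JW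
          (UnitaryGroup.adelicBlockDiag (Fp L) L (IsCMField.complexConj L) N₁ N₂ (Matrix.diagonal dV₁) (Matrix.diagonal dV₂)
            (g₁, 1)) *
        UnitaryGroup.adelicInr (Fp L) L (IsCMField.complexConj L) (N₁ + N₂) 1
          (UnitaryGroup.finSum N₁ N₂ (Matrix.diagonal dV₁) (Matrix.diagonal dV₂)) JW 1).1,
        mem_adelicPair_of_eq (Fp L) L (IsCMField.complexConj L) (N₁ + N₂) 1 (finSum_diagonal_append dV₁ dV₂)
          (diagonal_lineW L TW hJW).symm
          (UnitaryGroup.adelicInl (Fp L) L (IsCMField.complexConj L) (N₁ + N₂) 1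
          (UnitaryGroup.finSum N₁ N₂ (Matrix.diagonal dV₁) (Matrix.diagonal dV₂)) JW
          (UnitaryGroup.adelicBlockDiag (Fp L) L (IsCMField.complexConj L) N₁ N₂ (Matrix.diagonal dV₁) (Matrix.diagonal dV₂)
            (g₁, 1)) *
        UnitaryGroup.adelicInr (Fp L) L (IsCMField.complexConj L) (N₁ + N₂) 1
          (UnitaryGroup.finSum N₁ N₂ (Matrix.diagonal dV₁) (Matrix.diagonal dV₂)) JW 1).2⟩ :
        ↥(UnitaryGroup.adelicPair (Fp L) L (IsCMField.complexConj L) (N₁ + N₂) 1 (Matrix.diagonal (Fin.append dV₁ dV₂))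
          (Matrix.diagonal (lineW L TW)))))
          (sumTensor (Fp L) (idxSplit eV e₁ e₂) (piSBReindex (Fp L) e₁ Φ₁) (piSBReindex (Fp L) e₂ Φ₂))) :=
      congrArg (piSBReindex (Fp L) eV).symm
        ((omega_pairSplitting_chiSplittingSum_inl L eV dV₁ hdV₁ hdV₁0 dV₂ hdV₂ hdV₂0 χ hχu hχs TW hWd JW hJW g₁ _).trans
          (congrArg (adelicMpCont.omega (Fp L) (Fin n)
            (gramA L eV (Fin.append dV₁ dV₂) (complexConj_append L dV₁ dV₂ hdV₁ hdV₂) (lineW L TW) (complexConj_lineW L TW))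
            (chiSplitting L eV (Fin.append dV₁ dV₂) (complexConj_append L dV₁ dV₂ hdV₁ hdV₂)
              (append_ne_zero dV₁ dV₂ hdV₁0 hdV₂0) (lineW L TW) (complexConj_lineW L TW) (lineW_ne_zero L TW hWd) χ hχu hχs
              (⟨(UnitaryGroup.adelicInl (Fp L) L (IsCMField.complexConj L) (N₁ + N₂) 1
          (UnitaryGroup.finSum N₁ N₂ (Matrix.diagonal dV₁) (Matrix.diagonal dV₂)) JW
          (UnitaryGroup.adelicBlockDiag (Fp L) L (IsCMField.complexConj L) N₁ N₂ (Matrix.diagonal dV₁) (Matrix.diagonal dV₂)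
            (g₁, 1)) *
        UnitaryGroup.adelicInr (Fp L) L (IsCMField.complexConj L) (N₁ + N₂) 1
          (UnitaryGroup.finSum N₁ N₂ (Matrix.diagonal dV₁) (Matrix.diagonal dV₂)) JW 1).1,
        mem_adelicPair_of_eq (Fp L) L (IsCMField.complexConj L) (N₁ + N₂) 1 (finSum_diagonal_append dV₁ dV₂)
          (diagonal_lineW L TW hJW).symm
          (UnitaryGroup.adelicInl (Fp L) L (IsCMField.complexConj L) (N₁ + N₂) 1
          (UnitaryGroup.finSum N₁ N₂ (Matrix.diagonal dV₁) (Matrix.diagonal dV₂)) JW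
          (UnitaryGroup.adelicBlockDiag (Fp L) L (IsCMField.complexConj L) N₁ N₂ (Matrix.diagonal dV₁) (Matrix.diagonal dV₂)
            (g₁, 1)) *
        UnitaryGroup.adelicInr (Fp L) L (IsCMField.complexConj L) (N₁ + N₂) 1
          (UnitaryGroup.finSum N₁ N₂ (Matrix.diagonal dV₁) (Matrix.diagonal dV₂)) JW 1).2⟩ :
        ↥(UnitaryGroup.adelicPair (Fp L) L (IsCMField.complexConj L) (N₁ + N₂) 1 (Matrix.diagonal (Fin.append dV₁ dV₂))
          (Matrix.diagonal (lineW L TW))))))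
            (piSBReindex_sumTensor_kronecker (Fp L) eV e₁ e₂ Φ₁ Φ₂)))
    _ = (piSBReindex (Fp L) eV).symm (sumTensor (Fp L) (idxSplit eV e₁ e₂)
          (adelicMpCont.omega (Fp L) (Fin n₁) (gramA L e₁ dV₁ hdV₁ (lineW L TW) (complexConj_lineW L TW))
            (chiSplitting L e₁ dV₁ hdV₁ hdV₁0 (lineW L TW) (complexConj_lineW L TW) (lineW_ne_zero L TW hWd) χ hχu hχs
              (⟨(UnitaryGroup.adelicInl (Fp L) L (IsCMField.complexConj L) N₁ 1 (Matrix.diagonal dV₁) JW g₁ *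
        UnitaryGroup.adelicInr (Fp L) L (IsCMField.complexConj L) N₁ 1 (Matrix.diagonal dV₁) JW 1).1,
        mem_adelicPair_of_eq (Fp L) L (IsCMField.complexConj L) N₁ 1 rfl (diagonal_lineW L TW hJW).symm
          (UnitaryGroup.adelicInl (Fp L) L (IsCMField.complexConj L) N₁ 1 (Matrix.diagonal dV₁) JW g₁ *
        UnitaryGroup.adelicInr (Fp L) L (IsCMField.complexConj L) N₁ 1 (Matrix.diagonal dV₁) JW 1).2⟩ :
        ↥(UnitaryGroup.adelicPair (Fp L) L (IsCMField.complexConj L) N₁ 1 (Matrix.diagonal dV₁) (Matrix.diagonal (lineW L TW))))) (piSBReindex (Fp L) e₁ Φ₁))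
          (piSBReindex (Fp L) e₂ Φ₂)) := congrArg (piSBReindex (Fp L) eV).symm core
    _ = sumTensor (Fp L) ((finSumFinEquiv.prodCongr (Equiv.refl (Fin 1))).symm.trans
          (Equiv.sumProdDistrib (Fin N₁) (Fin N₂) (Fin 1)))
          ((piSBReindex (Fp L) e₁).symm (adelicMpCont.omega (Fp L) (Fin n₁)
            (gramA L e₁ dV₁ hdV₁ (lineW L TW) (complexConj_lineW L TW))
            (chiSplitting L e₁ dV₁ hdV₁ hdV₁0 (lineW L TW) (complexConj_lineW L TW) (lineW_ne_zero L TW hWd) χ hχu hχs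
              (⟨(UnitaryGroup.adelicInl (Fp L) L (IsCMField.complexConj L) N₁ 1 (Matrix.diagonal dV₁) JW g₁ *
        UnitaryGroup.adelicInr (Fp L) L (IsCMField.complexConj L) N₁ 1 (Matrix.diagonal dV₁) JW 1).1,
        mem_adelicPair_of_eq (Fp L) L (IsCMField.complexConj L) N₁ 1 rfl (diagonal_lineW L TW hJW).symm
          (UnitaryGroup.adelicInl (Fp L) L (IsCMField.complexConj L) N₁ 1 (Matrix.diagonal dV₁) JW g₁ *
        UnitaryGroup.adelicInr (Fp L) L (IsCMField.complexConj L) N₁ 1 (Matrix.diagonal dV₁) JW 1).2⟩ :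
        ↥(UnitaryGroup.adelicPair (Fp L) L (IsCMField.complexConj L) N₁ 1 (Matrix.diagonal dV₁) (Matrix.diagonal (lineW L TW))))) (piSBReindex (Fp L) e₁ Φ₁)))
          ((piSBReindex (Fp L) e₂).symm (piSBReindex (Fp L) e₂ Φ₂)) :=
      piSBReindex_symm_sumTensor_idxSplit _ _ _ _ _ _
    _ = _ :=
      congrArg₂ (sumTensor (Fp L) ((finSumFinEquiv.prodCongr (Equiv.refl (Fin 1))).symm.trans
          (Equiv.sumProdDistrib (Fin N₁) (Fin N₂) (Fin 1))))
        ((omega_seesawSmallLeft₁_apply (Fp L) L (IsCMField.complexConj L) N₁ N₂ 1 e₁ (Matrix.diagonal dV₁)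
            (Matrix.diagonal dV₂) JW (chiSplittingLine L e₁ dV₁ hdV₁ hdV₁0 χ hχu hχs TW hWd JW hJW) ((g₁, 1), 1) Φ₁).trans
          (congrArg (piSBReindex (Fp L) e₁).symm
            (omega_pairSplitting_chiSplittingLine_inl L e₁ dV₁ hdV₁ hdV₁0 χ hχu hχs TW hWd JW hJW g₁ _))).symm
        ((LinearEquiv.symm_apply_apply (piSBReindex (Fp L) e₂) Φ₂).trans
          ((omega_seesawSmallLeft₂_apply (Fp L) L (IsCMField.complexConj L) N₁ N₂ 1 e₂ (Matrix.diagonal dV₁)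
            (Matrix.diagonal dV₂) JW (chiSplittingLine L e₂ dV₂ hdV₂ hdV₂0 χ hχu hχs TW hWd JW hJW) ((g₁, 1), 1) Φ₂).trans
          ((congrArg (piSBReindex (Fp L) e₂).symm
            (omega_pairSplitting_chiSplittingLine_one L e₂ dV₂ hdV₂ hdV₂0 χ hχu hχs TW hWd JW hJW _)).trans
            (LinearEquiv.symm_apply_apply _ _))).symm)

/-- **THE SOCKET `stub_R` HOLDS**: the V-side see-saw character of the `χ`-splitting triple
`(s_χ^{V₁ ⊕ V₂}, s_χ^{V₁}, s_χ^{V₂})` over the hermitian line `⟨T_W⟩` is `1` at every `((g₁, 1), 1)`, `g₁ ∈ U(diag dV₁)(𝔸_{L⁺})`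
— by uniqueness of the see-saw scalar (★ `coe_mpSeesawChar_eq` with `c := 1`) from the pure-tensor identity
`omega_seesawBigLeft_chiSplittingSum_inl`; node R = (R1) + (R2) + (R1b) + (R3).
[cite: Liu2021, Thm. 4.15 proof l. 2199–2210] [cite: Kudla1994, §2 (doubled space, Siegel parabolic), Thm. 3.1]
[cite: GelbartRogawski1991, §3.1 Prop. 3.1.1 p. 455, Remark p. 457] -/
theorem seesawCharChiSplittingLineTrivial_holds : seesawCharChiSplittingLineTrivial := by
  intro L _ _ _ N₁ N₂ n n₁ n₂ eV e₁ e₂ dV₁ hdV₁ hdV₁0 dV₂ hdV₂ hdV₂0 χ hχu hχs TW hW hWd JW hJW g₁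
  rw [← Units.val_eq_one, mpSeesawCharLeft_def, mpSeesawCharSum_def]
  refine coe_mpSeesawChar_eq _ _ _ _ _ _ (fun Φ₁ Φ₂ => ?_)
  exact (omega_sumSeesawSplitting_apply _ _ _ _ _).trans
    (((congrArg (piSBReindex (Fp L) ((finSumFinEquiv.prodCongr (Equiv.refl (Fin 1))).symm.trans
        (Equiv.sumProdDistrib (Fin N₁) (Fin N₂) (Fin 1))))
        (omega_seesawBigLeft_chiSplittingSum_inl L eV e₁ e₂ dV₁ hdV₁ hdV₁0 dV₂ hdV₂ hdV₂0 χ hχu hχs TW hWd JW hJW g₁ Φ₁ Φ₂)).trans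
      (piSBReindex_sumTensor _ _ _ _)).trans (one_smul ℂ _).symm)

end Socket

end Literature.NumberTheory.Automorphic.Liu2021.Def411WeilCarriersDoubling

end
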